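import Literature.Computability.Learning.AmpEvalFP
import Literature.Computability.Complexity.CircuitClassesProofs
import Literature.Computability.Complexity.CircuitClassesUniformProofs
import Literature.Computability.Complexity.LengthCompare
import HarnessLib

/-!
# The NW outputs `g_z` of the learner have polynomial-size circuits (via `P ⊆ P/poly`)

Machine-layer instalment (M3) of the decomposition of the named fact
`Literature.Computability.Learning.cikk_natural_implies_learning` (CIKK 2016, Thm. 5.1): the
"nonuniform `Λ`-efficiency" of the black-box generator for `Λ =` all `B₂`-circuits (CIKK
Def. 3.1, proof of Thm. 3.2: "`g_z ∈ Λ^f[poly(m)]`", and proof of Thm. 5.1: "by replacing the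
`f`-oracle with the `Λ`-circuit for `f`, `g_z ∈ Λ[s_g]` for some `s_g ≤ poly(n, 1/ε, s_f)`").
Instead of building circuits we use `P ⊆ P/poly` (`P_subset_PPoly_holds`, the tableau
construction) and hard-wiring (`CktSize.hardwire`):

* `nwOutFn` — the ONE string function `⟨W, v⟩ ↦ [g_z(v)]`, `W = ⟨desc C, ⟨pad, ⟨1^q, ⟨1^ℓ,
  ⟨1^{n'}, ⟨1ⁿ, ⟨1ᵏ, z⟩⟩⟩⟩⟩⟩⟩` (the restriction brick of `NWDesignFP.lean`, then `AMP` through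
  the circuit description, `AmpEvalFP.lean`), in `FP`, one-bit on every input; its language
  `NWOutLang ∈ P`; `nwOutFn_apply`;
* `circuitSizeOver_nwOutput_le` — **for every `B₂`-circuit `C` for `f`, prime `q ≥ kn + k`,
  `ℓ` and seed `z`, the `ℓ`-variate function `v ↦ AMP(f)(z|_{S_v})` (the NW output on the
  explicit design, read as a truth table) has `B₂`-circuit size `≤ Q(|W| + ℓ)`** for ONE
  polynomial `Q` (that of `NWOutLang ∈ P/poly`), `|W|` the length of the hard-wired record.

## References

* M. Carmosino, R. Impagliazzo, V. Kabanets, A. Kolokolova, *Learning algorithms from natural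
  proofs*, CCC 2016, Def. 3.1, Thm. 3.2 (proof, nonuniform efficiency), Thm. 5.1 (proof)
  [CarmosinoImpagliazzoKabanetsKolokolova2016].
* S. Arora, B. Barak, *Computational Complexity: A Modern Approach*, CUP 2009, Thm. 6.6
  (`P ⊆ P/poly`), proof of Thm. 6.18 (hard-wiring) [AroraBarak2009].
-/

open Polynomial

namespace Literature.Computability.Learning

open Literature.Computability.Complexity Literature.Computability.Complexity.Brick
  Literature.Computability.Complexity.Plumb Literature.Computability.MetaComplexity
  Literature.Computability.Cryptography _root_.Computability

/-! ### The hard-wired record and the evaluation function -/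

/-- The record hard-wired into the circuit for `g_z`: circuit description, pad, the design
parameters in unary, and the seed. [folklore] -/
def nwOutRecord (d pad : List Bool) (q ℓ n' n k : ℕ) (zbits : List Bool) : List Bool :=
  boolPair d (boolPair pad (boolPair (ones q) (boolPair (ones ℓ) (boolPair (ones n')
    (boolPair (ones n) (boolPair (ones k) zbits))))))

/-- From `⟨W, v⟩` to the restriction record `⟨⟨pad, ⟨1^q, ⟨1^ℓ, ⟨v, z⟩⟩⟩⟩, 1^{n'}⟩`. [folklore] -/
noncomputable def toRestrictArg : List Bool → List Bool :=
  fanoutFn (fanoutFn (nthF 1 ∘ fstF) (fanoutFn (nthF 2 ∘ fstF) (fanoutFn (nthF 3 ∘ fstF)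
    (fanoutFn sndF (sndPow 6 ∘ fstF))))) (nthF 4 ∘ fstF)

/-- `toRestrictArg ∈ FP`. [folklore] -/
theorem toRestrictArg_mem_FP : toRestrictArg ∈ FP :=
  fanoutFn_mem_FP (fanoutFn_mem_FP (comp_mem_FP (nthF_mem_FP 1) fstF_mem_FP)
    (fanoutFn_mem_FP (comp_mem_FP (nthF_mem_FP 2) fstF_mem_FP)
      (fanoutFn_mem_FP (comp_mem_FP (nthF_mem_FP 3) fstF_mem_FP)
        (fanoutFn_mem_FP sndF_mem_FP (comp_mem_FP (sndPow_mem_FP 6) fstF_mem_FP)))))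
    (comp_mem_FP (nthF_mem_FP 4) fstF_mem_FP)

/-- Value of `toRestrictArg`. [folklore] -/
theorem toRestrictArg_apply (d pad : List Bool) (q ℓ n' n k : ℕ) (zbits vbits : List Bool) :
    toRestrictArg (boolPair (nwOutRecord d pad q ℓ n' n k zbits) vbits) =
      boolPair (designCtx pad q ℓ vbits zbits) (ones n') := by
  simp [toRestrictArg, nwOutRecord, designCtx, nthF, sndPow]

/-- From `⟨W, v⟩` (and the restricted string `u`) to the `AMP` argument `⟨d, ⟨⟨1ⁿ, 1ᵏ⟩, u⟩⟩`.
[folklore] -/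
noncomputable def toAmpArg : List Bool → List Bool :=
  fanoutFn (nthF 0 ∘ fstF) (fanoutFn (fanoutFn (nthF 5 ∘ fstF) (nthF 6 ∘ fstF))
    (restrictFn ∘ toRestrictArg))

/-- `toAmpArg ∈ FP`. [folklore] -/
theorem toAmpArg_mem_FP : toAmpArg ∈ FP :=
  fanoutFn_mem_FP (comp_mem_FP (nthF_mem_FP 0) fstF_mem_FP)
    (fanoutFn_mem_FP (fanoutFn_mem_FP (comp_mem_FP (nthF_mem_FP 5) fstF_mem_FP)
      (comp_mem_FP (nthF_mem_FP 6) fstF_mem_FP))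
      (comp_mem_FP restrictFn_mem_FP toRestrictArg_mem_FP))

/-- Value of `toAmpArg`. [folklore] -/
theorem toAmpArg_apply (d pad : List Bool) (q ℓ n' n k : ℕ) (zbits vbits : List Bool) :
    toAmpArg (boolPair (nwOutRecord d pad q ℓ n' n k zbits) vbits) =
      boolPair d (boolPair (boolPair (ones n) (ones k))
        (restrictFn (boolPair (designCtx pad q ℓ vbits zbits) (ones n')))) := by
  simp only [toAmpArg, fanoutFn_apply, Function.comp_apply, toRestrictArg_apply]
  simp [nwOutRecord, nthF]

/-- **The evaluation function of the NW outputs**: `⟨W, v⟩ ↦ [g_z(v)]` (one bit on every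
input, thanks to the final `headBitFn`). [cite: CarmosinoImpagliazzoKabanetsKolokolova2016, Thm. 3.2 (proof)] -/
noncomputable def nwOutFn : List Bool → List Bool := HashBricks.headBitFn ∘ ampCircFn ∘ toAmpArg

/-- **`nwOutFn ∈ FP`.** [cite: AroraBarak2009, Thm. 6.18 (proof)] -/
theorem nwOutFn_mem_FP : nwOutFn ∈ FP :=
  comp_mem_FP HashBricks.headBitFn_mem_FP (comp_mem_FP ampCircFn_mem_FP toAmpArg_mem_FP)

/-- **Value of `nwOutFn`** on a genuine record: the bit `AMP(f)(z|_{S_v})` for the function `f`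
computed by the circuit `C`. [cite: CarmosinoImpagliazzoKabanetsKolokolova2016, Thm. 3.2 (proof)] -/
theorem nwOutFn_apply {n k ℓ q : ℕ} [Fact q.Prime] (hn : k * n + k ≤ q) (C : Circuit (Fin n))
    (hC : C.IsOver B2) (pad : List Bool) (z : Fin (q * q) → Bool) (v : Fin ℓ → Bool) :
    nwOutFn (boolPair (nwOutRecord (CircEval.desc C) pad q ℓ (k * n + k) n k (List.ofFn z))
      (List.ofFn v)) = [ampFnFin (fun x => C.eval x) k (z ∘ cikkDesign q (k * n + k) ℓ hn v)] := by
  rw [nwOutFn, Function.comp_apply, Function.comp_apply, toAmpArg_apply,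
    restrictFn_eq_ofFn_cikkDesign pad q (k * n + k) ℓ hn v z, ampCircFn_apply_desc C hC k,
    HashBricks.headBitFn_apply]
  rfl

/-- `nwOutFn` answers one bit on every input. [folklore] -/
theorem nwOutFn_eq_singleton (w : List Bool) : nwOutFn w = [(ampCircFn (toAmpArg w)).headD false] := by
  rw [nwOutFn, Function.comp_apply, Function.comp_apply, HashBricks.headBitFn_apply]

/-- The language of `nwOutFn`. [folklore] -/
def NWOutLang : Language Bool := {w | nwOutFn w = [true]}

/-- **`NWOutLang ∈ P`.** [cite: AroraBarak2009, Thm. 6.18 (proof)] -/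
theorem NWOutLang_mem_P : NWOutLang ∈ Classes.P :=
  mem_P_of_mem_FP nwOutFn_mem_FP _ fun w => ⟨fun h => h, fun h => by
    have h' : nwOutFn w ≠ [true] := h
    rw [nwOutFn_eq_singleton] at h' ⊢
    cases hb : (ampCircFn (toAmpArg w)).headD false
    · rfl
    · rw [hb] at h'; exact absurd rfl h'⟩

/-! ### Hard-wiring the record: the circuit size of `g_z` -/

/-- **The NW outputs have polynomial-size circuits** (nonuniform efficiency of the black-box
generator for `Λ = B₂`-circuits, CIKK Def. 3.1 / proof of Thm. 3.2 and of Thm. 5.1): there is ONE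
polynomial `Q` such that for every `B₂`-circuit `C` (for `f`), every prime `q ≥ kn + k`, every
`ℓ`, pad and seed `z`, the function `v ↦ AMP(f)(z|_{S_v})` on `{0,1}^ℓ` — the NW output `g_z`
on the explicit design — has `B₂`-circuit size at most `Q(|W| + ℓ)`, `W` the hard-wired record.
[cite: CarmosinoImpagliazzoKabanetsKolokolova2016, Thm. 5.1 (proof: "`g_z ∈ Λ[s_g]`")] -/
theorem circuitSizeOver_nwOutput_le :
    ∃ Q : Polynomial ℕ, ∀ (n k ℓ q : ℕ) [Fact q.Prime] (hn : k * n + k ≤ q) (C : Circuit (Fin n)),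
      C.IsOver B2 → ∀ (pad : List Bool) (z : Fin (q * q) → Bool),
        circuitSizeOver B2 (fun v : Fin ℓ → Bool =>
          ampFnFin (fun x => C.eval x) k (z ∘ cikkDesign q (k * n + k) ℓ hn v)) ≤
          Q.eval ((nwOutRecord (CircEval.desc C) pad q ℓ (k * n + k) n k (List.ofFn z)).length + ℓ) := by
  obtain ⟨q₀, hq₀⟩ := exists_cktSize_boolPair_of_mem_PPoly (P_subset_PPoly_holds NWOutLang_mem_P)
  refine ⟨(2 * X + 2) + q₀.comp (2 * X + 2) + 2, ?_⟩
  intro n k ℓ q _ hn C hC pad z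
  set W := nwOutRecord (CircEval.desc C) pad q ℓ (k * n + k) n k (List.ofFn z) with hW
  -- the circuit for `(W', v) ↦ [⟨W', v⟩ ∈ NWOutLang]` on `|W| + ℓ` inputs
  have h1 := hq₀ W.length ℓ
  -- swap the two input blocks and hard-wire the first to `W`
  have h2 := (h1.rewire (ι' := Fin ℓ ⊕ Fin W.length) Sum.swap).hardwire W.get
  -- it computes `g_z`
  have h3 : CktSize B2 (fun (v : Fin ℓ → Bool) (_ : Unit) =>
      ampFnFin (fun x => C.eval x) k (z ∘ cikkDesign q (k * n + k) ℓ hn v))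
      ((2 * W.length + 2 + ℓ) + q₀.eval (2 * W.length + 2 + ℓ) + 2) := by
    refine h2.congr fun v u => ?_
    show Set.boolIndicator NWOutLang (boolPair (List.ofFn fun i => W.get i) (List.ofFn fun j => v j)) = _
    rw [show (List.ofFn fun i => W.get i) = W from List.ofFn_get W,
      show (List.ofFn fun j => v j) = List.ofFn v from rfl]
    have hmem : nwOutFn (boolPair W (List.ofFn v)) = [true] ↔
        ampFnFin (fun x => C.eval x) k (z ∘ cikkDesign q (k * n + k) ℓ hn v) = true := by
      rw [hW, nwOutFn_apply hn C hC pad z v, List.cons.injEq]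
      simp
    have key : nwOutFn (boolPair W (List.ofFn v)) = [true] ↔
        Set.boolIndicator NWOutLang (boolPair W (List.ofFn v)) = true :=
      Set.mem_iff_boolIndicator NWOutLang (boolPair W (List.ofFn v))
    cases hval : ampFnFin (fun x => C.eval x) k (z ∘ cikkDesign q (k * n + k) ℓ hn v)
    · have hne : ¬ Set.boolIndicator NWOutLang (boolPair W (List.ofFn v)) = true := fun h => by
        have h' := hmem.1 (key.2 h)
        rw [hval] at h'
        exact Bool.false_ne_true h'
      cases hbi : Set.boolIndicator NWOutLang (boolPair W (List.ofFn v))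
      · rfl
      · exact absurd hbi hne
    · exact key.1 (hmem.2 hval)
  obtain ⟨C', hC'B, hC's, hC'e⟩ := h3.toCircuit
  refine (circuitSizeOver_le_of_computes C' hC'B (fun v => hC'e v)).trans (hC's.trans ?_)
  simp only [eval_add, eval_mul, eval_ofNat, eval_X, eval_comp]
  have hmono : q₀.eval (2 * W.length + 2 + ℓ) ≤ q₀.eval (2 * (W.length + ℓ) + 2) :=
    TM2Iter.eval_mono q₀ (by omega)
  omega

end Literature.Computability.Learning
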